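import Mathlib
import Literature.MathematicalPhysics.QuantumFieldTheory.ConstructiveQFTWave0
import Literature.MathematicalPhysics.QuantumFieldTheory.AbelianTorusCochains
import Literature.Probability.LatticeModels.MaxwellKernelBand
import HarnessLib

/-!
# Crux `SelfNormalisedSkewness` (stmt-QuantumFields-18944, route `ScalingWindowSplit`), line `Sketch`:
# stub `stub_rangeProjectionKernel`

Stub B2 of the negation branch (the `U(1)` super-weak witness). Let `d : ℝ^{Edge 4 S} → ℝ^{Plaquette 4 S}`
be the real plaquette coboundary of the four-torus `(ℤ/S)⁴`,
`(dθ)(x, μν) = θ(x,μ) + θ(x+e_μ,ν) - θ(x+e_ν,μ) - θ(x,ν)` (`μ < ν`; this is the tree's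
`LatticeForm.td₁` of `AbelianTorusCochains.lean` restricted to the plaquettes), and let `Π` be the
orthogonal projection of `ℝ^{Plaquette 4 S}` (Euclidean inner product) onto `V = im d` — the
covariance of the standard Gaussian of `V`, i.e. of unit lattice Maxwell theory in plaquette
coordinates. We prove the closed formula for its matrix elements in terms of the zero-mode-free
torus Green function `G̃ = torusGreen` (`LatticeGreenFunction.lean`): with `n = x_p - x_q`,
`p = (x_p, μν)`, `q = (x_q, ρσ)` and `Hess_{ij}(n) = G̃(n+eᵢ) - G̃(n+eᵢ-eⱼ) - G̃(n) + G̃(n-eⱼ)`,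

`⟪Π e_p, e_q⟫ = ½ (-Hess_{μρ} δ_{νσ} + Hess_{μσ} δ_{νρ} + Hess_{νρ} δ_{μσ} - Hess_{νσ} δ_{μρ})`.

## Proof (position space)

* `torusGreen_negLaplacian`: `-Δ G̃ = 2δ₀ - 2/L^d` on `(ℤ/L)^d` (sum of the tree's
  `torusGreen_second_difference` over the directions: `∑_μ 2(1 - cos p_μ) = 2ε(p)` cancels the
  denominator, and `∑_k χ_k(z) = L^d [z = 0]`, `sum_torusChar_left`).
* `curlcurl`: the lattice identity `⟪dθ, db⟫ = ∑_{x,μ} θ(x,μ) (dᵀd b)(x,μ)` with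
  `(dᵀd b)(x,μ) = ∑_ν (td₁ b(x,μ,ν) - td₁ b(x-e_ν,μ,ν)) = (-Δ b_μ)(x) + div b(x+e_μ) - div b(x)`
  ("curl curl = -Δ + grad div", `curlcurl_pointwise`), by summation by parts on the torus
  (`sum_curl_mul`) and the passage from plaquettes `μ < ν` to ordered pairs (`sum_pairs_lt`).
* The explicit link potential `b_q` of the plaquette `q = (x_q, ρσ)`,
  `b_q(y,τ) = [τ=ρ] A_σ(y) - [τ=σ] A_ρ(y)`, `A_σ(y) = G̃(y-x_q) - G̃(y-x_q-e_σ)` (`= G̃ ∗ dᵀe_q`;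
  introduced through a defining hypothesis `hb`, no new definitions), is divergence free
  (`div_pot`) and has `-Δ b_q = 2 dᵀ e_q` (`negLap_greenDiff`; the zero-mode constants `2/S⁴`
  cancel in the differences), so `⟪dθ, d b_q⟫ = 2 (dθ)(q)` for every `θ` (`curlcurl_pot`), i.e.
  `e_q - ½ d b_q ⟂ im d`; hence `Π e_q = ½ d b_q` (`starProjection_single`, Mathlib's
  characterisation `Submodule.eq_starProjection_of_mem_of_inner_eq_zero`).
* Finally `⟪Π e_p, e_q⟫ = ⟪e_p, Π e_q⟫ = ½ (d b_q)(p)`, which is the displayed combination of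
  values of `G̃` (a `ring` identity once the torus sites are normalised).

Elementary; no single source is followed (the formula is the lattice `F_{μν}`-propagator of free
`U(1)` lattice gauge theory in Feynman gauge). Helper lemmas live in the sub-namespace
`RangeProjectionKernel`; the file introduces no definitions.
-/

noncomputable section

open scoped BigOperators InnerProductSpace
open Finset
open Literature.MathematicalPhysics.QuantumFieldTheory
open Literature.Probability.LatticeModels (TorusSite torusGreen torusChar latticeMomentum dispersion
  torusGreen_second_difference dispersion_latticeMomentum_eq_zero_iff_holds torusChar_re
  sum_torusChar_left)

namespace Summit.QuantumFields.YangMills.Theorems.SelfNormalisedSkewness.Negative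

namespace RangeProjectionKernel

/-! ### The Green identity `-Δ G̃ = 2δ₀ - 2 L^{-d}` -/

/-- **Minus the lattice Laplacian of the zero-mode-free torus Green function**: on `(ℤ/Lℤ)^d`,
`∑_μ (2G̃(z) - G̃(z+e_μ) - G̃(z-e_μ)) = 2·[z = 0] - 2/L^d` (`G̃ = torusGreen` is built on
`ε(p) = ∑ᵢ(1 - cos pᵢ)`, half the symbol of `-Δ`, whence the factor `2`; the constant `-2/L^d` is the
removed zero mode). From `torusGreen_second_difference` summed over `μ` and character orthogonality
`∑_k χ_k(z) = L^d [z = 0]`. [folklore] -/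
theorem torusGreen_negLaplacian {d L : ℕ} [NeZero L] (z : TorusSite d L) :
    ∑ μ, (2 * torusGreen z - torusGreen (z + Pi.single μ 1) - torusGreen (z - Pi.single μ 1)) =
      2 * (if z = 0 then 1 else 0) - 2 / (L : ℝ) ^ d := by
  simp_rw [torusGreen_second_difference]
  rw [← Finset.sum_div, Finset.sum_comm]
  have hε : ∀ k ∈ (univ : Finset (TorusSite d L)).erase 0,
      dispersion (latticeMomentum L k) ≠ 0 := fun k hk h =>
    (Finset.mem_erase.1 hk).1 ((dispersion_latticeMomentum_eq_zero_iff_holds k).1 h)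
  have h1 : ∀ k ∈ (univ : Finset (TorusSite d L)).erase 0,
      ∑ μ, 2 * (1 - Real.cos (latticeMomentum L k μ)) *
        Real.cos (∑ i, latticeMomentum L k i * ((z i).val : ℝ)) / dispersion (latticeMomentum L k) =
      2 * Real.cos (∑ i, latticeMomentum L k i * ((z i).val : ℝ)) := by
    intro k hk
    rw [← Finset.sum_div, ← Finset.sum_mul, ← Finset.mul_sum]
    unfold dispersion at hε ⊢
    rw [div_eq_iff (hε k hk)]
    ring
  rw [Finset.sum_congr rfl h1]
  have h2 : ∑ k ∈ (univ : Finset (TorusSite d L)).erase 0,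
      2 * Real.cos (∑ i, latticeMomentum L k i * ((z i).val : ℝ)) =
      2 * (∑ k, (torusChar k z).re) - 2 := by
    rw [Finset.sum_erase_eq_sub (Finset.mem_univ _), Finset.mul_sum]
    simp [torusChar_re, latticeMomentum]
  rw [h2, ← Complex.re_sum, sum_torusChar_left]
  have hL : ((L : ℝ) ^ d) ≠ 0 := pow_ne_zero _ (Nat.cast_ne_zero.2 (NeZero.ne L))
  split_ifs with hz
  · simp only [← Complex.ofReal_natCast, ← Complex.ofReal_pow, Complex.ofReal_re]
    field_simp
  · simp [neg_div]

/-! ### Lattice vector calculus on the four-torus -/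

/-- **From plaquettes to ordered pairs**: for `H : Fin n → Fin n → ℝ` vanishing on the diagonal,
`∑_{μ<ν} (H(μ,ν) + H(ν,μ)) = ∑_μ ∑_ν H(μ,ν)`. [folklore] -/
theorem sum_pairs_lt {n : ℕ} (H : Fin n → Fin n → ℝ) (h : ∀ μ, H μ μ = 0) :
    ∑ q : {q : Fin n × Fin n // q.1 < q.2}, (H q.1.1 q.1.2 + H q.1.2 q.1.1) = ∑ μ, ∑ ν, H μ ν := by
  classical
  have e1 : ∑ q : {q : Fin n × Fin n // q.1 < q.2}, (H q.1.1 q.1.2 + H q.1.2 q.1.1) =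
      ∑ q ∈ (univ : Finset (Fin n × Fin n)).filter (fun q => q.1 < q.2), (H q.1 q.2 + H q.2 q.1) :=
    (Finset.sum_subtype ((univ : Finset (Fin n × Fin n)).filter (fun q => q.1 < q.2)) (by simp)
      (fun q : Fin n × Fin n => H q.1 q.2 + H q.2 q.1)).symm
  rw [e1, Finset.sum_filter, ← Finset.univ_product_univ, Finset.sum_product]
  have hpt : ∀ μ ν, H μ ν = (if μ < ν then H μ ν else 0) + (if ν < μ then H μ ν else 0) := by
    intro μ ν
    rcases lt_trichotomy μ ν with hlt | rfl | hgt
    · simp [hlt, hlt.not_gt]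
    · simp [h]
    · simp [hgt, hgt.not_gt]
  have hrhs : ∑ μ, ∑ ν, H μ ν =
      ∑ μ, ∑ ν, (if μ < ν then H μ ν else 0) + ∑ μ, ∑ ν, (if ν < μ then H μ ν else 0) := by
    rw [← Finset.sum_add_distrib]
    refine Finset.sum_congr rfl fun μ _ => ?_
    rw [← Finset.sum_add_distrib]
    exact Finset.sum_congr rfl fun ν _ => hpt μ ν
  rw [hrhs, Finset.sum_comm (f := fun μ ν => if ν < μ then H μ ν else 0), ← Finset.sum_add_distrib]
  refine Finset.sum_congr rfl fun μ _ => ?_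
  rw [← Finset.sum_add_distrib]
  refine Finset.sum_congr rfl fun ν _ => ?_
  split_ifs <;> simp

variable {S : ℕ}

/-- **`curl curl = -Δ + grad div` on the cubic lattice** (pointwise, any link field `b`, with the
tree's torus coboundary `LatticeForm.td₁`):
`∑_ν (td₁ b(x,μ,ν) - td₁ b(x-e_ν,μ,ν)) = ∑_ν (2b_μ(x) - b_μ(x+e_ν) - b_μ(x-e_ν)) + (div b(x+e_μ) - div b(x))`
with `div b(y) = ∑_ν (b_ν(y) - b_ν(y-e_ν))`. Expand and cancel. [folklore] -/
theorem curlcurl_pointwise (b : Edge 4 S → ℝ) (x : Site 4 S) (μ : Fin 4) :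
    ∑ ν, (LatticeForm.td₁ (Function.curry b) x μ ν -
        LatticeForm.td₁ (Function.curry b) (x - Pi.single ν 1) μ ν) =
      ∑ ν, (2 * b (x, μ) - b (x + Pi.single ν 1, μ) - b (x - Pi.single ν 1, μ)) +
      (∑ ν, (b (x + Pi.single μ 1, ν) - b (x + Pi.single μ 1 - Pi.single ν 1, ν)) -
        ∑ ν, (b (x, ν) - b (x - Pi.single ν 1, ν))) := by
  rw [← Finset.sum_sub_distrib, ← Finset.sum_add_distrib]
  refine Finset.sum_congr rfl fun ν _ => ?_
  have e : x - Pi.single ν 1 + Pi.single μ 1 = x + Pi.single μ 1 - Pi.single ν 1 := by abel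
  simp only [LatticeForm.td₁, LatticeForm.te, Function.curry_apply, sub_add_cancel, e]
  ring

variable [NeZero S]

/-- **Summation by parts on the torus** for the coboundary paired with a site function:
`∑_x td₁ θ(x,μ,ν) ψ(x) = ∑_x (θ(x,μ)(ψ(x) - ψ(x-e_ν)) + θ(x,ν)(ψ(x-e_μ) - ψ(x)))`
(reindex `x ↦ x - e` in the two shifted terms, `Equiv.addRight`). [folklore] -/
theorem sum_curl_mul (θ : Edge 4 S → ℝ) (ψ : Site 4 S → ℝ) (μ ν : Fin 4) :
    ∑ x, LatticeForm.td₁ (Function.curry θ) x μ ν * ψ x =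
      ∑ x, (θ (x, μ) * (ψ x - ψ (x - Pi.single ν 1)) + θ (x, ν) * (ψ (x - Pi.single μ 1) - ψ x)) := by
  have h1 : ∑ x, θ (x + Pi.single μ 1, ν) * ψ x = ∑ x, θ (x, ν) * ψ (x - Pi.single μ 1) :=
    Fintype.sum_equiv (Equiv.addRight (Pi.single μ 1)) _ _ (fun x => by simp)
  have h2 : ∑ x, θ (x + Pi.single ν 1, μ) * ψ x = ∑ x, θ (x, μ) * ψ (x - Pi.single ν 1) :=
    Fintype.sum_equiv (Equiv.addRight (Pi.single ν 1)) _ _ (fun x => by simp)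
  simp only [LatticeForm.td₁, LatticeForm.te, Function.curry_apply, sub_mul, add_mul,
    Finset.sum_add_distrib, Finset.sum_sub_distrib, h1, h2, mul_sub]
  ring

/-- **The adjoint identity `⟪dθ, db⟫ = ⟪θ, dᵀd b⟫`** in position space: for link fields `θ, b` on
`(ℤ/S)⁴`,
`∑_x ∑_{μ<ν} td₁ θ(x,μ,ν) td₁ b(x,μ,ν) = ∑_x ∑_μ θ(x,μ) ∑_ν (td₁ b(x,μ,ν) - td₁ b(x-e_ν,μ,ν))`
(summation by parts `sum_curl_mul`, antisymmetry `LatticeForm.td₁_swap`, and `sum_pairs_lt`).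
[folklore] -/
theorem curlcurl (θ b : Edge 4 S → ℝ) :
    ∑ x, ∑ q : {q : Fin 4 × Fin 4 // q.1 < q.2},
        LatticeForm.td₁ (Function.curry θ) x q.1.1 q.1.2 *
          LatticeForm.td₁ (Function.curry b) x q.1.1 q.1.2 =
      ∑ x, ∑ μ, θ (x, μ) * ∑ ν, (LatticeForm.td₁ (Function.curry b) x μ ν -
        LatticeForm.td₁ (Function.curry b) (x - Pi.single ν 1) μ ν) := by
  set H : Site 4 S → Fin 4 → Fin 4 → ℝ := fun x α β => θ (x, α) *
    (LatticeForm.td₁ (Function.curry b) x α β -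
      LatticeForm.td₁ (Function.curry b) (x - Pi.single β 1) α β) with hH
  have hq : ∀ μ ν : Fin 4, ∑ x, LatticeForm.td₁ (Function.curry θ) x μ ν *
      LatticeForm.td₁ (Function.curry b) x μ ν = ∑ x, (H x μ ν + H x ν μ) := by
    intro μ ν
    rw [sum_curl_mul]
    refine Finset.sum_congr rfl fun x _ => ?_
    simp only [hH, LatticeForm.td₁_swap (Function.curry b) _ μ ν]
    ring
  rw [Finset.sum_comm]
  simp_rw [hq]
  rw [Finset.sum_comm]
  refine Finset.sum_congr rfl fun x _ => ?_
  rw [sum_pairs_lt (H x) (fun μ => by simp [hH])]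
  refine Finset.sum_congr rfl fun μ _ => ?_
  rw [Finset.mul_sum]

/-! ### The potential of a plaquette and its `dᵀd` -/

/-- **`-Δ A_σ = 2δ_{x_q} - 2δ_{x_q+e_σ}`** for the difference potential
`A_σ(y) = G̃(y-x_q) - G̃(y-x_q-e_σ)`: `∑_ν (2A_σ(x) - A_σ(x+e_ν) - A_σ(x-e_ν)) = 2[x=x_q] - 2[x=x_q+e_σ]`
(the Green identity `torusGreen_negLaplacian`; the zero-mode constants `2/S⁴` cancel). [folklore] -/
theorem negLap_greenDiff (xq : Site 4 S) (σ : Fin 4) (x : Site 4 S) :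
    ∑ ν, (2 * (torusGreen (x - xq) - torusGreen (x - xq - Pi.single σ 1)) -
      (torusGreen (x + Pi.single ν 1 - xq) - torusGreen (x + Pi.single ν 1 - xq - Pi.single σ 1)) -
      (torusGreen (x - Pi.single ν 1 - xq) - torusGreen (x - Pi.single ν 1 - xq - Pi.single σ 1))) =
      2 * (if x = xq then 1 else 0) - 2 * (if x = xq + Pi.single σ 1 then 1 else 0) := by
  have e : ∀ ν, 2 * (torusGreen (x - xq) - torusGreen (x - xq - Pi.single σ 1)) -
      (torusGreen (x + Pi.single ν 1 - xq) - torusGreen (x + Pi.single ν 1 - xq - Pi.single σ 1)) -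
      (torusGreen (x - Pi.single ν 1 - xq) - torusGreen (x - Pi.single ν 1 - xq - Pi.single σ 1)) =
      (2 * torusGreen (x - xq) - torusGreen ((x - xq) + Pi.single ν 1) -
        torusGreen ((x - xq) - Pi.single ν 1)) -
      (2 * torusGreen (x - xq - Pi.single σ 1) -
        torusGreen ((x - xq - Pi.single σ 1) + Pi.single ν 1) -
        torusGreen ((x - xq - Pi.single σ 1) - Pi.single ν 1)) := by
    intro ν
    simp only [add_sub_right_comm x _ xq, sub_right_comm _ (Pi.single ν 1),
      add_sub_right_comm (x - xq) _ (Pi.single σ 1)]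
    ring
  simp_rw [e]
  rw [Finset.sum_sub_distrib, torusGreen_negLaplacian, torusGreen_negLaplacian]
  simp only [sub_eq_zero]
  simp only [sub_eq_iff_eq_add']
  ring

/-- **The potential `b_q` of the plaquette `q = (x_q, ρσ)` is divergence free.** Here and below
`b = b_q` is the link field fixed by the defining hypothesis `hb`:
`b(y,τ) = [τ=ρ](G̃(y-x_q) - G̃(y-x_q-e_σ)) - [τ=σ](G̃(y-x_q) - G̃(y-x_q-e_ρ))` (`= G̃ ∗ dᵀe_q`,
`dᵀe_q = δ_{(x_q,ρ)} + δ_{(x_q+e_ρ,σ)} - δ_{(x_q+e_σ,ρ)} - δ_{(x_q,σ)}`); then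
`∑_ν (b(y,ν) - b(y-e_ν,ν)) = 0` (the boundary of a boundary vanishes). [folklore] -/
theorem div_pot (xq : Site 4 S) (ρ σ : Fin 4) (b : Edge 4 S → ℝ)
    (hb : ∀ y τ, b (y, τ) = (if τ = ρ then 1 else 0) *
        (torusGreen (y - xq) - torusGreen (y - xq - Pi.single σ 1)) -
      (if τ = σ then 1 else 0) * (torusGreen (y - xq) - torusGreen (y - xq - Pi.single ρ 1)))
    (y : Site 4 S) :
    ∑ ν, (b (y, ν) - b (y - Pi.single ν 1, ν)) = 0 := by
  simp only [hb, Finset.sum_sub_distrib, ite_mul, one_mul, zero_mul, Finset.sum_ite_eq',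
    Finset.mem_univ, if_true]
  simp only [sub_right_comm _ (Pi.single _ 1) xq, sub_right_comm _ (Pi.single σ 1) (Pi.single ρ 1)]
  ring

/-- **`dᵀd b_q = 2 dᵀe_q` pointwise** for the potential `b = b_q` of `div_pot`:
`∑_ν (td₁ b(x,μ,ν) - td₁ b(x-e_ν,μ,ν)) = 2([μ=ρ]([x=x_q] - [x=x_q+e_σ]) - [μ=σ]([x=x_q] - [x=x_q+e_ρ]))`
(`curlcurl_pointwise`, `div_pot`, `negLap_greenDiff`). [folklore] -/
theorem curlcurl_pot_pointwise (xq : Site 4 S) (ρ σ : Fin 4) (b : Edge 4 S → ℝ)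
    (hb : ∀ y τ, b (y, τ) = (if τ = ρ then 1 else 0) *
        (torusGreen (y - xq) - torusGreen (y - xq - Pi.single σ 1)) -
      (if τ = σ then 1 else 0) * (torusGreen (y - xq) - torusGreen (y - xq - Pi.single ρ 1)))
    (x : Site 4 S) (μ : Fin 4) :
    ∑ ν, (LatticeForm.td₁ (Function.curry b) x μ ν -
        LatticeForm.td₁ (Function.curry b) (x - Pi.single ν 1) μ ν) =
      2 * ((if μ = ρ then 1 else 0) *
          ((if x = xq then 1 else 0) - (if x = xq + Pi.single σ 1 then 1 else 0)) -
        (if μ = σ then 1 else 0) *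
          ((if x = xq then 1 else 0) - (if x = xq + Pi.single ρ 1 then 1 else 0))) := by
  rw [curlcurl_pointwise, div_pot xq ρ σ b hb, div_pot xq ρ σ b hb, sub_self, add_zero]
  have e : ∀ ν, 2 * b (x, μ) - b (x + Pi.single ν 1, μ) - b (x - Pi.single ν 1, μ) =
      (if μ = ρ then 1 else 0) *
        (2 * (torusGreen (x - xq) - torusGreen (x - xq - Pi.single σ 1)) -
          (torusGreen (x + Pi.single ν 1 - xq) -
            torusGreen (x + Pi.single ν 1 - xq - Pi.single σ 1)) -
          (torusGreen (x - Pi.single ν 1 - xq) -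
            torusGreen (x - Pi.single ν 1 - xq - Pi.single σ 1))) -
      (if μ = σ then 1 else 0) *
        (2 * (torusGreen (x - xq) - torusGreen (x - xq - Pi.single ρ 1)) -
          (torusGreen (x + Pi.single ν 1 - xq) -
            torusGreen (x + Pi.single ν 1 - xq - Pi.single ρ 1)) -
          (torusGreen (x - Pi.single ν 1 - xq) -
            torusGreen (x - Pi.single ν 1 - xq - Pi.single ρ 1))) := by
    intro ν
    simp only [hb]
    ring
  simp_rw [e]
  rw [Finset.sum_sub_distrib, ← Finset.mul_sum, ← Finset.mul_sum, negLap_greenDiff,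
    negLap_greenDiff]
  ring

/-- **`⟪dθ, d b_q⟫ = 2 (dθ)(q)`** for every link field `θ` and the potential `b = b_q` of `div_pot`:
`b_q` solves the normal equations of the projection of `e_q` onto `im d` up to the factor `2`
(`curlcurl` + `curlcurl_pot_pointwise`, then evaluate the delta sums). [folklore] -/
theorem curlcurl_pot (xq : Site 4 S) (ρ σ : Fin 4) (b : Edge 4 S → ℝ)
    (hb : ∀ y τ, b (y, τ) = (if τ = ρ then 1 else 0) *
        (torusGreen (y - xq) - torusGreen (y - xq - Pi.single σ 1)) -
      (if τ = σ then 1 else 0) * (torusGreen (y - xq) - torusGreen (y - xq - Pi.single ρ 1)))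
    (θ : Edge 4 S → ℝ) :
    ∑ x, ∑ q : {q : Fin 4 × Fin 4 // q.1 < q.2},
        LatticeForm.td₁ (Function.curry θ) x q.1.1 q.1.2 *
          LatticeForm.td₁ (Function.curry b) x q.1.1 q.1.2 =
      2 * LatticeForm.td₁ (Function.curry θ) xq ρ σ := by
  rw [curlcurl]
  simp_rw [curlcurl_pot_pointwise xq ρ σ b hb]
  have e : ∀ (x : Site 4 S) (μ : Fin 4), θ (x, μ) * (2 * ((if μ = ρ then 1 else 0) *
      ((if x = xq then 1 else 0) - (if x = xq + Pi.single σ 1 then 1 else 0)) -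
      (if μ = σ then 1 else 0) *
        ((if x = xq then 1 else 0) - (if x = xq + Pi.single ρ 1 then 1 else 0)))) =
      (if μ = ρ then (if x = xq then 2 * θ (x, μ) else 0) else 0) -
      (if μ = ρ then (if x = xq + Pi.single σ 1 then 2 * θ (x, μ) else 0) else 0) -
      (if μ = σ then (if x = xq then 2 * θ (x, μ) else 0) else 0) +
      (if μ = σ then (if x = xq + Pi.single ρ 1 then 2 * θ (x, μ) else 0) else 0) := by
    intro x μ
    split_ifs <;> ring
  simp_rw [e]
  simp only [Finset.sum_add_distrib, Finset.sum_sub_distrib, Finset.sum_ite_eq', Finset.mem_univ,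
    if_true]
  simp only [LatticeForm.td₁, LatticeForm.te, Function.curry_apply]
  ring

/-! ### The projection onto `im d` -/

/-- The Euclidean inner product of two exact plaquette fields in terms of `LatticeForm.td₁`:
`⟪d b, d θ⟫ = ∑_x ∑_{μ<ν} td₁ θ(x,μ,ν) td₁ b(x,μ,ν)` for the plaquette coboundary `d` described by
`hd`. [folklore] -/
theorem inner_d_d (d : (Edge 4 S → ℝ) →ₗ[ℝ] EuclideanSpace ℝ (Plaquette 4 S))
    (hd : ∀ (θ : Edge 4 S → ℝ) (x : Site 4 S) (q : {q : Fin 4 × Fin 4 // q.1 < q.2}),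
      d θ (x, q) = θ (x, q.1.1) + θ (x + Pi.single q.1.1 1, q.1.2) -
        θ (x + Pi.single q.1.2 1, q.1.1) - θ (x, q.1.2))
    (θ b : Edge 4 S → ℝ) :
    ⟪d b, d θ⟫_ℝ = ∑ x, ∑ q : {q : Fin 4 × Fin 4 // q.1 < q.2},
        LatticeForm.td₁ (Function.curry θ) x q.1.1 q.1.2 *
          LatticeForm.td₁ (Function.curry b) x q.1.1 q.1.2 := by
  rw [PiLp.inner_apply, Fintype.sum_prod_type]
  refine Finset.sum_congr rfl fun x _ => Finset.sum_congr rfl fun q _ => ?_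
  rw [RCLike.inner_apply, conj_trivial, hd, hd]
  rfl

/-- **The orthogonal projection of a basis vector onto the exact plaquette fields**:
`Π e_q = ½ d b_q` for `q = (x_q, ρσ)` and the potential `b = b_q` of `div_pot` — `½ d b_q ∈ im d`
and `e_q - ½ d b_q ⟂ im d` by `curlcurl_pot` (Mathlib's characterisation
`Submodule.eq_starProjection_of_mem_of_inner_eq_zero`). [folklore] -/
theorem starProjection_single (d : (Edge 4 S → ℝ) →ₗ[ℝ] EuclideanSpace ℝ (Plaquette 4 S))
    (hd : ∀ (θ : Edge 4 S → ℝ) (x : Site 4 S) (q : {q : Fin 4 × Fin 4 // q.1 < q.2}),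
      d θ (x, q) = θ (x, q.1.1) + θ (x + Pi.single q.1.1 1, q.1.2) -
        θ (x + Pi.single q.1.2 1, q.1.1) - θ (x, q.1.2))
    (xq : Site 4 S) (a : {q : Fin 4 × Fin 4 // q.1 < q.2}) (b : Edge 4 S → ℝ)
    (hb : ∀ y τ, b (y, τ) = (if τ = a.1.1 then 1 else 0) *
        (torusGreen (y - xq) - torusGreen (y - xq - Pi.single a.1.2 1)) -
      (if τ = a.1.2 then 1 else 0) *
        (torusGreen (y - xq) - torusGreen (y - xq - Pi.single a.1.1 1))) :
    (LinearMap.range d).starProjection (EuclideanSpace.single (xq, a) (1 : ℝ)) =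
      (1 / 2 : ℝ) • d b := by
  apply Submodule.eq_starProjection_of_mem_of_inner_eq_zero
  · exact Submodule.smul_mem _ _ (LinearMap.mem_range_self d _)
  · rintro w ⟨θ, rfl⟩
    rw [inner_sub_left, real_inner_smul_left, EuclideanSpace.inner_single_left, map_one, one_mul,
      inner_d_d d hd, curlcurl_pot xq a.1.1 a.1.2 b hb, hd]
    simp only [LatticeForm.td₁, LatticeForm.te, Function.curry_apply]
    ring

end RangeProjectionKernel

open RangeProjectionKernel

/-- **Stub `stub_rangeProjectionKernel`** (B2) of line `Sketch`, crux `SelfNormalisedSkewness`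
(stmt-QuantumFields-18944), registered signature verbatim. For the real plaquette coboundary `d` of
`(ℤ/S)⁴`, the orthogonal projection `Π` onto `im d` has matrix elements
`⟪Π e_p, e_q⟫ = ½ (-Hess_{μρ} δ_{νσ} + Hess_{μσ} δ_{νρ} + Hess_{νρ} δ_{μσ} - Hess_{νσ} δ_{μρ})`,
`Hess_{ij} = Hess_{ij} G̃ (x_p - x_q)`, `Hess_{ij}G̃(n) = G̃(n+eᵢ) - G̃(n+eᵢ-eⱼ) - G̃(n) + G̃(n-eⱼ)`,
`p = (x_p, μν)`, `q = (x_q, ρσ)`. Proof: `⟪Π e_p, e_q⟫ = ⟪e_p, Π e_q⟫ = ½ (d b_q)(p)`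
(`RangeProjectionKernel.starProjection_single`) and bookkeeping. [folklore] -/
theorem stub_rangeProjectionKernel (S : ℕ) [NeZero S] (d : (Edge 4 S → ℝ) →ₗ[ℝ] EuclideanSpace ℝ (Plaquette 4 S)) (hd : ∀ (θ : Edge 4 S → ℝ) (x : Site 4 S) (q : {q : Fin 4 × Fin 4 // q.1 < q.2}), d θ (x, q) = θ (x, q.1.1) + θ (x + Pi.single q.1.1 1, q.1.2) - θ (x + Pi.single q.1.2 1, q.1.1) - θ (x, q.1.2)) (p q : Plaquette 4 S) : ⟪(LinearMap.range d).starProjection (EuclideanSpace.single p (1 : ℝ)), EuclideanSpace.single q (1 : ℝ)⟫_ℝ = (1 / 2 : ℝ) * (-(torusGreen ((p.1 - q.1 : TorusSite 4 S) + Pi.single p.2.1.1 1) - torusGreen ((p.1 - q.1 : TorusSite 4 S) + Pi.single p.2.1.1 1 - Pi.single q.2.1.1 1) - torusGreen ((p.1 - q.1 : TorusSite 4 S)) + torusGreen ((p.1 - q.1 : TorusSite 4 S) - Pi.single q.2.1.1 1)) * (if p.2.1.2 = q.2.1.2 then 1 else 0) + (torusGreen ((p.1 - q.1 : TorusSite 4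 S) + Pi.single p.2.1.1 1) - torusGreen ((p.1 - q.1 : TorusSite 4 S) + Pi.single p.2.1.1 1 - Pi.single q.2.1.2 1) - torusGreen ((p.1 - q.1 : TorusSite 4 S)) + torusGreen ((p.1 - q.1 : TorusSite 4 S) - Pi.single q.2.1.2 1)) * (if p.2.1.2 = q.2.1.1 then 1 else 0) + (torusGreen ((p.1 - q.1 : TorusSite 4 S) + Pi.single p.2.1.2 1) - torusGreen ((p.1 - q.1 : TorusSite 4 S) + Pi.single p.2.1.2 1 - Pi.single q.2.1.1 1) - torusGreen ((p.1 - q.1 : TorusSite 4 S)) + torusGreen ((p.1 - q.1 : TorusSite 4 S) - Pi.single q.2.1.1 1)) * (if p.2.1.1 = q.2.1.2 then 1 else 0) - (torusGreen ((p.1 - q.1 : TorusSite 4 S) + Pi.single p.2.1.2 1) - torusGreen ((p.1 - q.1 : TorusSite 4 S) + Pi.single p.2.1.2 1 - Pi.single q.2.1.2 1) - torusGreen ((p.1 - q.1 : TorusSite 4 S)) + torusGreen ((p.1 - q.1 : TorusSite 4 S) - Pi.single q.2.1.2 1)) * (if p.2.1.1 = q.2.1.1 then 1 else 0)) := by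
  obtain ⟨xp, ⟨⟨μ, ν⟩, hμν⟩⟩ := p
  obtain ⟨xq, a⟩ := q
  -- the link potential `b_q = G̃ ∗ dᵀe_q` of the plaquette `q = (x_q, a)`
  set b : Edge 4 S → ℝ := fun e => (if e.2 = a.1.1 then (1 : ℝ) else 0) *
      (torusGreen (e.1 - xq) - torusGreen (e.1 - xq - Pi.single a.1.2 1)) -
    (if e.2 = a.1.2 then 1 else 0) *
      (torusGreen (e.1 - xq) - torusGreen (e.1 - xq - Pi.single a.1.1 1))
  have hb : ∀ y τ, b (y, τ) = (if τ = a.1.1 then 1 else 0) *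
        (torusGreen (y - xq) - torusGreen (y - xq - Pi.single a.1.2 1)) -
      (if τ = a.1.2 then 1 else 0) *
        (torusGreen (y - xq) - torusGreen (y - xq - Pi.single a.1.1 1)) := fun y τ => rfl
  rw [Submodule.inner_starProjection_left_eq_right, starProjection_single d hd xq a b hb,
    real_inner_smul_right, EuclideanSpace.inner_single_left, map_one, one_mul, hd]
  simp only [hb, add_sub_right_comm xp _ xq]
  ring

end Summit.QuantumFields.YangMills.Theorems.SelfNormalisedSkewness.Negative

end
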